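import Literature.NumberTheory.Transcendental.AyoubRelative
import Mathlib.LinearAlgebra.Quotient.Basic

/-!
# Ayoub's relative Kontsevich–Zagier theorem (revisited) — proved special cases

Sibling of `Literature/NumberTheory/Transcendental/AyoubRelative.lean`, which defines the objects
(`𝒪 = k[z, t, t⁻¹]` as `O k`, `∫ = intO`, `∂/∂zᵢ = dz`, `|_{zᵢ=c} = restr`, `tⱼ∂/∂tⱼ = euler`,
term-by-term integration `intLaurent`, algebraic Laurent series `Odagger`, `ayoubGenerators`) and the
NAMED FACT `Literature.NumberTheory.Transcendental.AyoubRel.ayoub_relativeKZ_revisited` — J. Ayoub, *La version relative de la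
conjecture des périodes de Kontsevich–Zagier revisitée*, Tohoku Math. J. (2) 71 (2019) 465–485
(author's preprint `rel-KZ-bis`), **Théorème 1.7**: on `𝒪†_alg(𝔸^∞ × 𝔼^∞)` the kernel of
`∫ : 𝒪((ϖ)) → k((ϖ))` is the `k`-span of (a) `∂G/∂zᵢ - G|_{zᵢ=1} + G|_{zᵢ=0}`, (b) `tⱼ ∂H/∂tⱼ`,
`G, H ∈ 𝒪†_alg`.

The inclusion "`ker ∫ ⊆ span`" for a GENERAL algebraic series is the deep content of the note (§2:
Voevodsky motives over `k(ϖ)`, rigid-analytic motives, the Betti realisation and the torsor of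
periods; Théorèmes 2.4 and 2.6 there) and remains a named fact. This file proves it, unconditionally
and over any field of characteristic `0`, in the sub-case where all the "periods" are rational
numbers — `F` a Laurent POLYNOMIAL in `ϖ`:

1. **Polynomial level** (Lemme 1.4's antiderivative computation, dualised): on `𝒪`, every `f` is
   congruent to `(∫ f) · 1` modulo the `k`-span of the relations `∂g/∂zᵢ - g|₁ + g|₀`, `tⱼ ∂h/∂tⱼ`
   (`g, h ∈ 𝒪`): a monomial with a `t`-part is `bⱼ⁻¹ · tⱼ∂ⱼ` of itself, and
   `z^a ≡ (aᵢ+1)⁻¹ · z^a|_{aᵢ:=0}` by the relation for `zᵢ · z^a`; hence `ker ∫ ≤ span`.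
   (`sub_intO_smul_mono_zero_mem`, `mem_of_intO_eq_zero`, `ker_intO_le_span_relations`.)
2. **Laurent polynomials in `ϖ` are algebraic**: if `F ∈ 𝒪((ϖ))` has finite support then
   `ϖ^N · F = p(ϖ)` with `p ∈ 𝒪[ϖ]`, so `F ∈ 𝒪†_alg`. (`isAlgebraicLaurent_of_finite_support`.)
3. **Théorème 1.7, direction `⇒`, for `ϖ`-Laurent polynomials**: a finitely supported
   `F ∈ 𝒪((ϖ))` with `∫ F = 0` lies in `span_k (ayoubGenerators k)`; the generators used are of the
   form `∂G/∂zᵢ - G|₁ + G|₀`, `tⱼ ∂H/∂tⱼ` with `G, H` MONOMIALS `g · ϖ^r`, which are in `𝒪†_alg` by 2.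
   (`mem_span_ayoubGenerators_of_finite_support`, `ayoub_relativeKZ_revisited_finiteSupport`.)

This is a non-vacuity and orientation check of the vendored generators in the hard direction; it
needs neither an embedding `k ↪ ℂ` nor any transcendence input.

## References

* J. Ayoub, *La version relative de la conjecture des périodes de Kontsevich–Zagier revisitée*,
  Tohoku Math. J. (2) 71 (2019), no. 3, 465–485, doi:10.2748/tmj/1568772181; preprint
  `https://user.math.uzh.ch/ayoub/PDF-Files/rel-KZ-bis.pdf`: Lemmes 1.4–1.5, Notation 1.6,
  Théorème 1.7 (bib key `AyoubRelKZRevisited`).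
* J. Ayoub, *Une version relative de la conjecture des périodes de Kontsevich–Zagier*, Ann. of
  Math. (2) 181 (2015) 905–992.
-/

noncomputable section

open Finsupp Polynomial

namespace Literature.NumberTheory.Transcendental.AyoubRel

variable {k : Type} [Field k]

/-! ### 1. The polynomial level: `ker ∫ ≤ span (relations)` on `𝒪 = k[z, t, t⁻¹]`

Throughout, `S` is any `k`-subspace of `𝒪` containing all `∂g/∂zᵢ - g|_{zᵢ=1} + g|_{zᵢ=0}`
(`hA`) and all `tⱼ ∂h/∂tⱼ` (`hB`), `g, h ∈ 𝒪`; the smallest one is the span of these relations. -/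

/-- A monomial with a non-trivial `t`-part is itself a relation:
`z^a t^b = bⱼ⁻¹ · tⱼ ∂(z^a t^b)/∂tⱼ` for any `j` with `bⱼ ≠ 0`.
[Ayoub, revisited note, Théorème 1.7 (b)] [folklore] -/
theorem mono_mem_of_snd_ne_zero [CharZero k] {S : Submodule k (O k)}
    (hB : ∀ (j : ℕ) (h : O k), euler k j h ∈ S) (m : Mono) (hm : m.2 ≠ 0) : mono k m ∈ S := by
  obtain ⟨j, hj⟩ : ∃ j, m.2 j ≠ 0 := by
    by_contra h
    exact hm (Finsupp.ext fun j => not_not.mp (not_exists.mp h j))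
  have hjk : ((m.2 j : ℤ) : k) ≠ 0 := Int.cast_ne_zero.mpr hj
  have h2 : mono k m = ((m.2 j : ℤ) : k)⁻¹ • euler k j (mono k m) := by
    rw [euler_mono, smul_smul, inv_mul_cancel₀ hjk, one_smul]
  rw [h2]
  exact S.smul_mem _ (hB j _)

/-- The type (a) relation for the monomial `zᵢ · z^a` reads `(aᵢ + 1) · z^a - z^a|_{zᵢ=1} + 0`,
so `z^a ≡ (aᵢ+1)⁻¹ · z^{a|aᵢ:=0}` modulo the relations.
[Ayoub, revisited note, Lemme 1.4 / Théorème 1.7 (a)] [folklore] -/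
theorem mono_sub_smul_mono_erase_mem [CharZero k] {S : Submodule k (O k)}
    (hA : ∀ (i : ℕ) (g : O k), relA k i g ∈ S) (a : ℕ →₀ ℕ) (i : ℕ) :
    mono k (a, 0) - (((a i : ℕ) : k) + 1)⁻¹ • mono k (a.erase i, 0) ∈ S := by
  have key := hA i (mono k (a + Finsupp.single i 1, 0))
  have e1 : (a + Finsupp.single i 1 : ℕ →₀ ℕ) i = a i + 1 := by
    rw [Finsupp.add_apply, Finsupp.single_eq_same]
  have e2 : (a + Finsupp.single i 1 : ℕ →₀ ℕ) - Finsupp.single i 1 = a :=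
    add_tsub_cancel_right _ _
  have e3 : (a + Finsupp.single i 1 : ℕ →₀ ℕ).erase i = a.erase i := by
    rw [Finsupp.erase_add, Finsupp.erase_single, add_zero]
  have hrel : relA k i (mono k (a + Finsupp.single i 1, 0)) =
      (((a i : ℕ) : k) + 1) • mono k (a, 0) - mono k (a.erase i, 0) := by
    simp only [relA, LinearMap.add_apply, LinearMap.sub_apply, dz_mono, restr_mono, e1, e2, e3,
      one_pow, one_smul, pow_succ, mul_zero, mul_one, zero_smul, add_zero, Nat.cast_add,
      Nat.cast_one]
  rw [hrel] at key
  have hne : ((a i : ℕ) : k) + 1 ≠ 0 := Nat.cast_add_one_ne_zero _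
  have : mono k (a, 0) - (((a i : ℕ) : k) + 1)⁻¹ • mono k (a.erase i, 0) =
      (((a i : ℕ) : k) + 1)⁻¹ • ((((a i : ℕ) : k) + 1) • mono k (a, 0) - mono k (a.erase i, 0)) := by
    rw [smul_sub, smul_smul, inv_mul_cancel₀ hne, one_smul]
  rw [this]
  exact S.smul_mem _ key

/-- The `z`-weight of a monomial without `t`-part, `∫ z^a = ∏ᵢ (aᵢ + 1)⁻¹` (definitional
unfolding). [Ayoub, revisited note, Lemme 1.4] [folklore] -/
theorem monoWeight_eq_prod_of_snd_eq_zero (a : ℕ →₀ ℕ) :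
    monoWeight k (a, 0) = ∏ i ∈ a.support, ((a i : k) + 1)⁻¹ :=
  if_pos rfl

/-- The `z`-weight satisfies the same recursion: `∫ z^a = (aᵢ+1)⁻¹ · ∫ z^{a|aᵢ:=0}`.
[Ayoub, revisited note, Lemme 1.4] [folklore] -/
theorem monoWeight_eq_inv_mul_monoWeight_erase (a : ℕ →₀ ℕ) (i : ℕ) :
    monoWeight k (a, 0) = (((a i : ℕ) : k) + 1)⁻¹ * monoWeight k (a.erase i, 0) := by
  classical
  rw [monoWeight_eq_prod_of_snd_eq_zero, monoWeight_eq_prod_of_snd_eq_zero]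
  by_cases hi : i ∈ a.support
  · rw [← Finset.mul_prod_erase _ _ hi, Finsupp.support_erase]
    congr 1
    refine Finset.prod_congr rfl fun j hj => ?_
    rw [Finsupp.erase_ne (Finset.ne_of_mem_erase hj)]
  · rw [Finsupp.erase_of_notMem_support hi, Finsupp.notMem_support_iff.mp hi]
    simp

/-- Every `z`-monomial is congruent to its integral times `1` modulo the type (a) relations:
`z^a ≡ (∏ᵢ (aᵢ+1)⁻¹) · 1`. [Ayoub, revisited note, Lemme 1.4] [folklore] -/
theorem mono_sub_monoWeight_smul_mem_of_snd_eq_zero [CharZero k] {S : Submodule k (O k)}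
    (hA : ∀ (i : ℕ) (g : O k), relA k i g ∈ S) (a : ℕ →₀ ℕ) :
    mono k (a, 0) - monoWeight k (a, 0) • mono k 0 ∈ S := by
  classical
  suffices h : ∀ (s : Finset ℕ) (a : ℕ →₀ ℕ), a.support ⊆ s →
      mono k (a, 0) - monoWeight k (a, 0) • mono k 0 ∈ S from h a.support a subset_rfl
  intro s
  induction s using Finset.induction_on with
  | empty =>
    intro a ha
    have h0 : a = 0 := by simpa using ha
    subst h0
    have hw : monoWeight k ((0 : ℕ →₀ ℕ), (0 : ℕ →₀ ℤ)) = 1 := by simp [monoWeight]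
    rw [hw, one_smul]
    exact (sub_self (mono k 0)).symm ▸ S.zero_mem
  | insert i s hi ih =>
    intro a ha
    have hsub : (a.erase i).support ⊆ s := by
      rw [Finsupp.support_erase]
      exact Finset.subset_insert_iff.mp ha
    have h1 := mono_sub_smul_mono_erase_mem hA a i
    have h2 := ih (a.erase i) hsub
    set c : k := (((a i : ℕ) : k) + 1)⁻¹ with hc
    have : mono k (a, 0) - monoWeight k (a, 0) • mono k 0 =
        (mono k (a, 0) - c • mono k (a.erase i, 0)) +
          c • (mono k (a.erase i, 0) - monoWeight k (a.erase i, 0) • mono k 0) := by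
      rw [monoWeight_eq_inv_mul_monoWeight_erase a i, ← hc, smul_sub, smul_smul]
      abel
    rw [this]
    exact S.add_mem h1 (S.smul_mem _ h2)

/-- Every monomial is congruent to its integral times `1` modulo the relations:
`z^a t^b ≡ (∫ z^a t^b) · 1`. [Ayoub, revisited note, Lemmes 1.4–1.5] [folklore] -/
theorem mono_sub_monoWeight_smul_mem [CharZero k] {S : Submodule k (O k)}
    (hA : ∀ (i : ℕ) (g : O k), relA k i g ∈ S) (hB : ∀ (j : ℕ) (h : O k), euler k j h ∈ S)
    (m : Mono) : mono k m - monoWeight k m • mono k 0 ∈ S := by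
  obtain ⟨a, b⟩ := m
  by_cases hb : b = 0
  · subst hb
    exact mono_sub_monoWeight_smul_mem_of_snd_eq_zero hA a
  · rw [show monoWeight k (a, b) = 0 from if_neg hb, zero_smul, sub_zero]
    exact mono_mem_of_snd_ne_zero hB (a, b) hb

/-- **Every `f ∈ 𝒪` is congruent to `(∫ f) · 1` modulo the relations** `∂g/∂zᵢ - g|₁ + g|₀`,
`tⱼ ∂h/∂tⱼ`. [Ayoub, revisited note, Lemmes 1.4–1.5 / Théorème 1.7 (polynomial level)] [folklore] -/
theorem sub_intO_smul_mono_zero_mem [CharZero k] {S : Submodule k (O k)}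
    (hA : ∀ (i : ℕ) (g : O k), relA k i g ∈ S) (hB : ∀ (j : ℕ) (h : O k), euler k j h ∈ S)
    (f : O k) : f - intO k f • mono k 0 ∈ S := by
  induction f using AddMonoidAlgebra.induction_linear with
  | zero => simp
  | add f g hf hg =>
    have : f + g - intO k (f + g) • mono k 0 =
        (f - intO k f • mono k 0) + (g - intO k g • mono k 0) := by
      rw [map_add, add_smul]
      abel
    rw [this]
    exact S.add_mem hf hg
  | single m r =>
    have hs : (AddMonoidAlgebra.single m r : O k) = r • mono k m := by
      rw [mono, AddMonoidAlgebra.smul_single, smul_eq_mul, mul_one]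
    rw [hs, map_smul, intO_mono, smul_eq_mul, mul_smul, ← smul_sub]
    exact S.smul_mem _ (mono_sub_monoWeight_smul_mem hA hB m)

/-- **The polynomial level of Théorème 1.7, hard direction**: if `∫ f = 0` then `f` lies in every
subspace containing the relations `∂g/∂zᵢ - g|₁ + g|₀`, `tⱼ ∂h/∂tⱼ` (`g, h ∈ 𝒪`).
[Ayoub, revisited note, Théorème 1.7 (polynomial level)] [folklore] -/
theorem mem_of_intO_eq_zero [CharZero k] {S : Submodule k (O k)}
    (hA : ∀ (i : ℕ) (g : O k), relA k i g ∈ S) (hB : ∀ (j : ℕ) (h : O k), euler k j h ∈ S)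
    (f : O k) (hf : intO k f = 0) : f ∈ S := by
  simpa [hf] using sub_intO_smul_mono_zero_mem hA hB f

/-- `ker ∫ ≤ span_k {∂g/∂zᵢ - g|₁ + g|₀} ∪ {tⱼ ∂h/∂tⱼ}` on `𝒪`.
[Ayoub, revisited note, Théorème 1.7 (polynomial level)] [folklore] -/
theorem ker_intO_le_span_relations [CharZero k] :
    LinearMap.ker (intO k) ≤ Submodule.span k
      ((Set.range fun p : ℕ × O k => relA k p.1 p.2) ∪ Set.range fun p : ℕ × O k => euler k p.1 p.2) :=
  fun f hf =>
    mem_of_intO_eq_zero (fun i g => Submodule.subset_span (Or.inl ⟨(i, g), rfl⟩))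
      (fun j h => Submodule.subset_span (Or.inr ⟨(j, h), rfl⟩)) f (LinearMap.mem_ker.mp hf)

/-! ### 2. Laurent polynomials in `ϖ`: coefficients, monomials, algebraicity -/

/-- Coefficients of a coefficientwise image (definitional). [folklore] -/
@[simp] theorem coeff_mapCoeff {V W : Type} [AddCommGroup V] [Module k V] [AddCommGroup W]
    [Module k W] (f : V →ₗ[k] W) (F : LaurentSeries V) (n : ℤ) :
    (mapCoeff k f F).coeff n = f (F.coeff n) := rfl

/-- Coefficientwise maps send monomials to monomials: `f_*(v ϖ^n) = f(v) ϖ^n`. [folklore] -/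
theorem mapCoeff_single {V W : Type} [AddCommGroup V] [Module k V] [AddCommGroup W] [Module k W]
    (f : V →ₗ[k] W) (n : ℤ) (v : V) :
    mapCoeff k f (HahnSeries.single n v) = HahnSeries.single n (f v) := by
  ext m
  rw [coeff_mapCoeff]
  by_cases h : m = n
  · subst h
    rw [HahnSeries.coeff_single_same, HahnSeries.coeff_single_same]
  · rw [HahnSeries.coeff_single_of_ne h, HahnSeries.coeff_single_of_ne h, map_zero]

/-- `∫ F = 0` term by term means `∫ Fₙ = 0` for every coefficient. [folklore] -/
theorem intO_coeff_eq_zero_of_intLaurent_eq_zero (F : LaurentSeries (O k))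
    (h : intLaurent k F = 0) (n : ℤ) : intO k (F.coeff n) = 0 := by
  have := congrArg (fun G : LaurentSeries k => G.coeff n) h
  simpa [intLaurent] using this

/-- A Laurent series supported in a finite set is the (finite) sum of its monomials. [folklore] -/
theorem eq_sum_single_of_support_subset {V : Type} [AddCommGroup V] (F : LaurentSeries V)
    (s : Finset ℤ) (hs : F.support ⊆ s) : F = ∑ n ∈ s, HahnSeries.single n (F.coeff n) := by
  ext m
  rw [HahnSeries.coeff_sum, Finset.sum_eq_single m]
  · rw [HahnSeries.coeff_single_same]
  · intro n _ hn
    exact HahnSeries.coeff_single_of_ne hn.symm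
  · intro hm
    rw [HahnSeries.coeff_single_same]
    by_contra h
    exact hm (hs h)

/-- `ϖ ↦ ϖ`: the polynomial variable goes to the Laurent monomial `ϖ = single 1 1`. [folklore] -/
theorem polyToLaurent_X : polyToLaurent k X = HahnSeries.single 1 1 := by
  simp [polyToLaurent]

/-- Constants go to constants under `𝒪[ϖ] → 𝒪((ϖ))` (Mathlib's `𝒪`-algebra structure on
`𝒪((ϖ))` factors through `𝒪[[ϖ]]`, whence the detour). [folklore] -/
theorem polyToLaurent_C (c : O k) : polyToLaurent k (Polynomial.C c) = HahnSeries.C c := by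
  rw [polyToLaurent, Polynomial.aeval_C, HahnSeries.algebraMap_apply', PowerSeries.algebraMap_eq,
    HahnSeries.ofPowerSeries_C]

/-- `c ϖ^m ↦ c ϖ^m` under `𝒪[ϖ] → 𝒪((ϖ))`. [folklore] -/
theorem polyToLaurent_C_mul_X_pow (c : O k) (m : ℕ) :
    polyToLaurent k (Polynomial.C c * X ^ m) = HahnSeries.single (m : ℤ) c := by
  rw [map_mul, map_pow, polyToLaurent_X, HahnSeries.single_pow, polyToLaurent_C,
    HahnSeries.C_apply, HahnSeries.single_mul_single, zero_add, one_pow, mul_one, nsmul_eq_mul,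
    mul_one]

/-- **Laurent polynomials in `ϖ` are algebraic**: a finitely supported `F ∈ 𝒪((ϖ))` satisfies
`ϖ^N F - p(ϖ) = 0` for some `N` and `p ∈ 𝒪[ϖ]`, a non-zero polynomial relation of degree `1`;
hence `F ∈ 𝒪†_alg`. [Ayoub, revisited note, Notation 1.6] [folklore] -/
theorem isAlgebraicLaurent_of_finite_support (F : LaurentSeries (O k)) (hF : F.support.Finite) :
    IsAlgebraicLaurent k F := by
  classical
  set s : Finset ℤ := hF.toFinset with hs_def
  have hs : F.support ⊆ s := fun n hn => by simpa [hs_def] using hn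
  set N : ℕ := s.sup fun n => (-n).toNat with hN_def
  have hN : ∀ n ∈ s, 0 ≤ (N : ℤ) + n := fun n hn => by
    have : (-n).toNat ≤ N := Finset.le_sup (f := fun n : ℤ => (-n).toNat) hn
    omega
  set p : Polynomial (O k) := ∑ n ∈ s, Polynomial.C (F.coeff n) * X ^ ((N : ℤ) + n).toNat
    with hp_def
  refine ⟨Polynomial.C (X ^ N) * X - Polynomial.C p, ?_, ?_⟩
  · intro h
    have h1 := congrArg (fun P : Polynomial (Polynomial (O k)) => P.coeff 1) h
    simp only [Polynomial.coeff_sub, Polynomial.coeff_C_mul, Polynomial.coeff_X_one, mul_one,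
      Polynomial.coeff_C, one_ne_zero, if_false, sub_zero, Polynomial.coeff_zero] at h1
    exact (Polynomial.monic_X_pow N).ne_zero h1
  · rw [Polynomial.eval₂_sub, Polynomial.eval₂_mul, Polynomial.eval₂_C, Polynomial.eval₂_X,
      Polynomial.eval₂_C, sub_eq_zero]
    simp only [AlgHom.toRingHom_eq_coe, AlgHom.coe_toRingHom, map_pow, polyToLaurent_X,
      HahnSeries.single_pow, one_pow]
    conv_lhs => rw [eq_sum_single_of_support_subset F s hs]
    rw [Finset.mul_sum, hp_def, map_sum]
    refine Finset.sum_congr rfl fun n hn => ?_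
    rw [HahnSeries.single_mul_single, polyToLaurent_C_mul_X_pow, one_mul,
      Int.toNat_of_nonneg (hN n hn)]
    simp

/-- In particular the Laurent monomials `g ϖ^n` are algebraic. [folklore] -/
theorem isAlgebraicLaurent_single (n : ℤ) (g : O k) :
    IsAlgebraicLaurent k (HahnSeries.single n g) :=
  isAlgebraicLaurent_of_finite_support _
    ((Set.finite_singleton n).subset HahnSeries.support_single_subset)

/-! ### 3. Théorème 1.7, direction `⇒`, for Laurent polynomials in `ϖ` -/

/-- A monomial `g ϖ^n` with `∫ g = 0` is in the span of Ayoub's generators (with `G, H` Laurent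
monomials, which are algebraic). [Ayoub, revisited note, Théorème 1.7 (⇒, monomial case)]
[cite: AyoubRelKZRevisited, Théorème 1.7] -/
theorem single_mem_span_ayoubGenerators [CharZero k] (n : ℤ) (g : O k) (hg : intO k g = 0) :
    HahnSeries.single n g ∈ Submodule.span k (ayoubGenerators k) := by
  -- pull the span back to `𝒪` along the `k`-linear inclusion `x ↦ x ϖ^n`
  let ι : O k →ₗ[k] LaurentSeries (O k) := HahnSeries.single.linearMap n
  have hA : ∀ (i : ℕ) (x : O k), relA k i x ∈ (Submodule.span k (ayoubGenerators k)).comap ι :=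
    fun i x => Submodule.mem_comap.mpr (by
      show HahnSeries.single n (relA k i x) ∈ Submodule.span k (ayoubGenerators k)
      rw [← mapCoeff_single]
      exact Submodule.subset_span (Or.inl ⟨_, isAlgebraicLaurent_single n x, i, rfl⟩))
  have hB : ∀ (j : ℕ) (x : O k), euler k j x ∈ (Submodule.span k (ayoubGenerators k)).comap ι :=
    fun j x => Submodule.mem_comap.mpr (by
      show HahnSeries.single n (euler k j x) ∈ Submodule.span k (ayoubGenerators k)
      rw [← mapCoeff_single]
      exact Submodule.subset_span (Or.inr ⟨_, isAlgebraicLaurent_single n x, j, rfl⟩))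
  exact Submodule.mem_comap.mp (mem_of_intO_eq_zero hA hB g hg)

/-- **Théorème 1.7, `⇒`, for `ϖ`-Laurent polynomials**: a finitely supported `F ∈ 𝒪((ϖ))` with
`∫ F = 0` (term by term) is a `k`-linear combination of Ayoub's generators.
[Ayoub, revisited note, Théorème 1.7 (⇒, finite-support case)]
[cite: AyoubRelKZRevisited, Théorème 1.7] -/
theorem mem_span_ayoubGenerators_of_finite_support [CharZero k] (F : LaurentSeries (O k))
    (hF : F.support.Finite) (h0 : intLaurent k F = 0) :
    F ∈ Submodule.span k (ayoubGenerators k) := by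
  classical
  rw [eq_sum_single_of_support_subset F hF.toFinset (fun n hn => by simpa using hn)]
  exact Submodule.sum_mem _ fun n _ =>
    single_mem_span_ayoubGenerators n (F.coeff n) (intO_coeff_eq_zero_of_intLaurent_eq_zero F h0 n)

/-- **Ayoub, revisited note, Théorème 1.7 — the case of `ϖ`-Laurent polynomials, proved.** In the
shape of the named fact `ayoub_relativeKZ_revisited` (whose general `→` is motivic and stays a
named fact): for every field `k` of characteristic `0` (no embedding into `ℂ` needed) and every
finitely supported `F ∈ 𝒪((ϖ))`, `F` belongs to `𝒪†_alg` and `∫ F = 0 → F ∈ span_k (generators)`.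
[Ayoub, revisited note, Théorème 1.7 (finite-support case)] [cite: AyoubRelKZRevisited, Théorème 1.7] -/
theorem ayoub_relativeKZ_revisited_finiteSupport :
    ∀ (k : Type) [Field k] [CharZero k], ∀ F : LaurentSeries (O k), F.support.Finite →
      F ∈ Odagger k ∧ (intLaurent k F = 0 → F ∈ Submodule.span k (ayoubGenerators k)) :=
  fun _ _ _ F hF =>
    ⟨isAlgebraicLaurent_of_finite_support F hF, mem_span_ayoubGenerators_of_finite_support F hF⟩

end Literature.NumberTheory.Transcendental.AyoubRel
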